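import Mathlib
import Literature.NumberTheory.Transcendental.BrownMotivicMZV
import Literature.NumberTheory.Transcendental.NesterenkoCriterion
import Literature.NumberTheory.Transcendental.MultipleZetaValues

/-!
# Sketch — crux `HoffmanIndependence` (stmt-KontsevichZagierPeriods-15045), crux-ideate round 1, ideator 1

First lemmas of the two idea cards (signatures over existing declarations; proofs are NOT
required at this stage — the two elementary ones are nevertheless closed, the rest are `sorry`).

* `crux_iff_finset`      — the crux is the conjunction of its finite blocks (finitary reduction
                            used by both cards).
* `rung3_of_crux`        — the first open rung `{1, ζ(2), ζ(3)}` is an instance of the crux.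
* CARD `simultaneous-pade-amplification`:
    `linearIndependent_cons_one_of_simultaneous` (simultaneous-approximation criterion — PROVED) and
    `crux_of_density` / `finrank_hoffmanSpan_le_of_relation` (prime-ideal amplification over
    `Brown2012.MotivicMZV`, stated).
* CARD `overconvergent-apery-companion`:
    `rational_section_of_relation` (PROVED: a ℚ-relation turns simultaneous Apéry limits into a
    ℚ-coefficient overconvergent section), `crux_of_overconvergentWitnesses` (PROVED: shape of the
    transfer, the Calegari–Dimitrov–Tang holonomy bound abstracted as a hypothesis), and the Apéry
    companion data `aperyRec/aperyA/aperyB/aperyV` with stubs `aperyV_limit/remainder/type`.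
-/

namespace Summit.KontsevichZagierPeriods.KontsevichZagierPeriods.Cruxes.HoffmanIndependence.Sketch

open Literature.NumberTheory.Transcendental MZV Filter Topology
open scoped BigOperators

/-- The crux VERBATIM (signature of `Theses.LinRedNormalForm.HoffmanIndependence`, rev 7 of the
route file = `Theses.FurushoPentagon.MzvPeriodConjecture`; the route module is not imported here only
because the farm's olean of `Theses/LinRedNormalForm.lean` predates rev 6 at session time —
`Unknown identifier HoffmanIndependence` on import; the equation `Crux = HoffmanIndependence` is `rfl`). -/
abbrev Crux : Prop :=
  LinearIndependent ℚ (fun u : {u : List ℕ // IsHoffman u} => multipleZeta u.1)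

/-- Finitary form: the crux is the conjunction of its finite blocks. -/
theorem crux_iff_finset :
    Crux ↔ ∀ s : Finset {u : List ℕ // IsHoffman u},
      LinearIndependent ℚ ((fun u : {u : List ℕ // IsHoffman u} => multipleZeta u.1) ∘
        (Subtype.val : s → {u : List ℕ // IsHoffman u})) :=
  linearIndependent_iff_finset_linearIndependent

/-- The Hoffman words `∅, (2), (3)` as an injection `Fin 3 → {u // IsHoffman u}`. -/
def rung3Words : Fin 3 → {u : List ℕ // IsHoffman u} :=
  ![⟨[], fun _ h => by simp at h⟩, ⟨[2], fun i h => by simp at h; omega⟩,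
    ⟨[3], fun i h => by simp at h; omega⟩]

theorem rung3Words_injective : Function.Injective rung3Words := by
  intro i j h
  fin_cases i <;> fin_cases j <;> simp_all [rung3Words]

/-- First open rung (weight ≤ 3 block `1, ζ(2), ζ(3)`; open: Dauguet–Zudilin 2014, CDT 2024 §1)
is an instance of the crux. -/
theorem rung3_of_crux (h : Crux) :
    LinearIndependent ℚ (fun i : Fin 3 => multipleZeta (rung3Words i).1) :=
  h.comp rung3Words rung3Words_injective

/-! ### CARD `simultaneous-pade-amplification` -/

/-- **Simultaneous-approximation criterion** (the hinge of Hermite–Padé lines): integer vectors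
`(qₙ; pₙ,₁,…,pₙ,ₘ)` with `qₙθᵢ − pₙ,ᵢ → 0` for every `i`, not eventually annihilated by any fixed
non-zero integer covector, force `1, θ₁, …, θₘ` to be `ℚ`-linearly independent.
(PROVED here, via `LinearIndependent.iff_fractionRing ℤ ℚ`: an integer relation `(a; b)` gives the INTEGERS
`a qₙ + ∑ bᵢ pₙ,ᵢ = −∑ bᵢ (qₙθᵢ − pₙ,ᵢ) → 0`, hence eventually `0`, contradicting `hnondeg`.) -/
theorem linearIndependent_cons_one_of_simultaneous {m : ℕ} (θ : Fin m → ℝ)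
    (q : ℕ → ℤ) (p : ℕ → Fin m → ℤ)
    (hsmall : ∀ i, Tendsto (fun n => (q n : ℝ) * θ i - p n i) atTop (𝓝 0))
    (hnondeg : ∀ (a : ℤ) (b : Fin m → ℤ), (a ≠ 0 ∨ b ≠ 0) →
      ∃ᶠ n in atTop, (a : ℝ) * q n + ∑ i, (b i : ℝ) * p n i ≠ 0) :
    LinearIndependent ℚ (Fin.cons (1 : ℝ) θ) := by
  refine (LinearIndependent.iff_fractionRing ℤ ℚ).1 ?_
  rw [Fintype.linearIndependent_iff]
  intro g hg
  -- split the relation: g 0 • 1 + ∑ g (succ i) • θ i = 0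
  rw [Fin.sum_univ_succ] at hg
  simp only [Fin.cons_zero, Fin.cons_succ, zsmul_eq_mul, mul_one] at hg
  set a : ℤ := g 0 with ha
  set b : Fin m → ℤ := fun i => g i.succ with hb
  have hrel : (a : ℝ) + ∑ i, (b i : ℝ) * θ i = 0 := by simpa [ha, hb] using hg
  by_contra hne
  -- some coefficient is non-zero
  have hab : a ≠ 0 ∨ b ≠ 0 := by
    by_contra h
    push Not at h
    apply hne
    intro i
    refine Fin.cases ?_ (fun j => ?_) i
    · simpa [ha] using h.1
    · simpa [hb] using congrFun h.2 j
  -- the integer sequence z n := a q_n + ∑ b_i p_{n,i}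
  set z : ℕ → ℤ := fun n => a * q n + ∑ i, b i * p n i with hz
  have hzreal : ∀ n, (z n : ℝ) = -(∑ i, (b i : ℝ) * ((q n : ℝ) * θ i - p n i)) := by
    intro n
    have h1 : ∑ i, (b i : ℝ) * ((q n : ℝ) * θ i - p n i) =
        (∑ i, (b i : ℝ) * θ i) * q n - ∑ i, (b i : ℝ) * p n i := by
      rw [Finset.sum_mul, ← Finset.sum_sub_distrib]
      refine Finset.sum_congr rfl fun i _ => ?_
      ring
    have h2 : (z n : ℝ) = (a : ℝ) * q n + ∑ i, (b i : ℝ) * p n i := by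
      simp [hz]
    rw [h2, h1]
    have h3 : (∑ i, (b i : ℝ) * θ i) = -(a : ℝ) := by linarith
    rw [h3]
    ring
  -- it tends to 0
  have hztend : Tendsto (fun n => (z n : ℝ)) atTop (𝓝 0) := by
    have : Tendsto (fun n => -(∑ i, (b i : ℝ) * ((q n : ℝ) * θ i - p n i))) atTop (𝓝 (-(∑ i : Fin m, (b i : ℝ) * 0))) := by
      refine Tendsto.neg ?_
      refine tendsto_finsetSum _ fun i _ => ?_
      exact (hsmall i).const_mul _
    simp only [mul_zero, Finset.sum_const_zero, neg_zero] at this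
    refine this.congr fun n => ?_
    rw [hzreal n]
  -- hence eventually zero
  have hev : ∀ᶠ n in atTop, z n = 0 := by
    have := (Metric.tendsto_nhds.1 hztend) 1 one_pos
    filter_upwards [this] with n hn
    rw [Real.dist_eq, sub_zero] at hn
    have : |z n| < 1 := by exact_mod_cast hn
    exact Int.abs_lt_one_iff.1 this
  -- contradiction with non-degeneracy
  have hfr := hnondeg a b hab
  obtain ⟨n, hn1, hn2⟩ := (hfr.and_eventually hev).exists
  apply hn1
  have : ((z n : ℤ) : ℝ) = 0 := by rw [hn2]; simp
  simpa [hz] using this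

/-- **Prime-ideal amplification** (transfer of the card). Over Brown's motivic MZVs
(`Brown2012.MotivicMZV`: `H`, weight pieces `Hw`, period map `per`, `J ∘ ρ` = motivic MZVs) with
`H` a domain graded by the `Hw N` of dimension `d_N` spanned by the motivic Hoffman elements
(Brown 2012 Thm 1.1 / 7.4, Lemma 2.5), ONE `ℚ`-relation among real Hoffman values of weight `≤ N`
is a non-zero `R ∈ ker per ∩ H_{≤N}`, and `R · H_{≤K−N} ⊆ ker per ∩ H_{≤K}` injectively, so
`dim_ℚ (∑_{k≤K} hoffmanSpan k) ≤ d_{≤K} − d_{≤K−N}` for every `K ≥ N`. Contrapositive: the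
asymptotic counting hypothesis `hdense` implies the crux. -/
theorem crux_of_density (M : Brown2012.MotivicMZV) [IsDomain M.H]
    (hgr : iSupIndep M.Hw) (htop : ⨆ N, M.Hw N = ⊤)
    (hdim : ∀ N, Module.finrank ℚ (M.Hw N) = zagierDim N)
    (hhoff : ∀ N, Submodule.span ℚ (Set.range fun w : {w : List ℕ // IsHoffman w ∧ weight w = N} =>
        M.J (Brown2012.rho w.1.reverse)) = M.Hw N)
    (hdense : ∀ N : ℕ, ∃ K : ℕ, N ≤ K ∧
      (∑ k ∈ Finset.range (K + 1), zagierDim k) - (∑ k ∈ Finset.range (K - N + 1), zagierDim k) <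
        Module.finrank ℚ ↥(⨆ k ∈ Finset.range (K + 1), hoffmanSpan k)) :
    Crux := by
  sorry

/-- The counting inequality itself (the amplification step, stated separately): one relation of
weight `≤ N` caps the Hoffman span in every weight range `≤ K`. -/
theorem finrank_hoffmanSpan_le_of_relation (M : Brown2012.MotivicMZV) [IsDomain M.H]
    (hgr : iSupIndep M.Hw) (htop : ⨆ N, M.Hw N = ⊤)
    (hdim : ∀ N, Module.finrank ℚ (M.Hw N) = zagierDim N)
    (hhoff : ∀ N, Submodule.span ℚ (Set.range fun w : {w : List ℕ // IsHoffman w ∧ weight w = N} =>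
        M.J (Brown2012.rho w.1.reverse)) = M.Hw N)
    {N : ℕ} (l : {u : List ℕ // IsHoffman u} →₀ ℚ) (hl : l ≠ 0)
    (hwt : ∀ u ∈ l.support, weight u.1 ≤ N)
    (hrel : (l.sum fun u c => (c : ℝ) * multipleZeta u.1) = 0) (K : ℕ) (hK : N ≤ K) :
    Module.finrank ℚ ↥(⨆ k ∈ Finset.range (K + 1), hoffmanSpan k) ≤
      (∑ k ∈ Finset.range (K + 1), zagierDim k) - (∑ k ∈ Finset.range (K - N + 1), zagierDim k) := by
  sorry

/-! ### CARD `overconvergent-holonomic-modules` -/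

/-- **A ℚ-relation turns simultaneous Apéry limits into a rational small section** (the step
of Calegari–Dimitrov–Tang 2024, Prop. 11.2-type, on the first rung): if `qₙ, pₙ, p′ₙ ∈ ℚ` are
simultaneous approximations (`qₙζ(2) − pₙ`, `qₙζ(3) − p′ₙ` small) and `a + bζ(2) + cζ(3) = 0`,
then the RATIONAL sequence `hₙ = a qₙ + b pₙ + c p′ₙ` equals `−(b rₙ + c r′ₙ)`, hence is small:
its generating function `∑ hₙ xⁿ ∈ ℚ⟦x⟧` keeps the denominator type of `(pₙ, p′ₙ)` and the radius
of convergence of the remainders — the overconvergent section a holonomy bound must exclude. -/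
theorem rational_section_of_relation (q p p' : ℕ → ℚ) (a b c : ℚ)
    (hrel : (a : ℝ) + b * multipleZeta [2] + c * multipleZeta [3] = 0) (n : ℕ) :
    ((a * q n + b * p n + c * p' n : ℚ) : ℝ) =
      -((b : ℝ) * ((q n : ℝ) * multipleZeta [2] - p n) +
        (c : ℝ) * ((q n : ℝ) * multipleZeta [3] - p' n)) := by
  push_cast
  linear_combination (q n : ℝ) * hrel

/-- Apéry's third-order recurrence `n³uₙ − (2n−1)(17n²−17n+5)uₙ₋₁ + (n−1)³uₙ₋₂ = R(n)` solved forward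
over `ℚ` from `u₀, u₁` (inhomogeneous term `R`). -/
def aperyRec (R : ℕ → ℚ) (u0 u1 : ℚ) : ℕ → ℚ
  | 0 => u0
  | 1 => u1
  | (n + 2) =>
      ((2 * (n + 2 : ℚ) - 1) * (17 * (n + 2 : ℚ) ^ 2 - 17 * (n + 2 : ℚ) + 5) * aperyRec R u0 u1 (n + 1)
        - ((n + 1 : ℚ)) ^ 3 * aperyRec R u0 u1 n + R (n + 2)) / ((n + 2 : ℚ)) ^ 3

/-- Apéry numbers `aₙ = 1, 5, 73, 1445, …` (integral solution). -/
def aperyA : ℕ → ℚ := aperyRec (fun _ => 0) 1 5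
/-- Apéry's second solution `bₙ = 0, 6, 351/4, …` (`bₙ/aₙ → ζ(3)`, `dₙ³bₙ ∈ ℤ`). -/
def aperyB : ℕ → ℚ := aperyRec (fun _ => 0) 0 6
/-- **The ζ(2)-companion** (this session, kit j015499/j015521 + local re-check): the solution with
inhomogeneous term `R(n) = 2n − 1`, `v₀ = 0, v₁ = 1`: `v = 0, 1, 15, 2674/9, 61070/9, 37890259/225, …`. -/
def aperyV : ℕ → ℚ := aperyRec (fun n => 2 * (n : ℚ) - 1) 0 1

example : aperyA 3 = 1445 ∧ aperyB 2 = 351 / 4 ∧ aperyV 5 = 37890259 / 225 := by native_decide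

/-- STUB (numerical to 308 digits, n = 200): the companion's Apéry limit is `ζ(2)/8`. -/
theorem aperyV_limit :
    Tendsto (fun n : ℕ => (aperyV n : ℝ) / (aperyA n : ℝ)) atTop (𝓝 (multipleZeta [2] / 8)) := by
  sorry

/-- STUB (numerical: `n²eₙ → −1/16`): the remainder decays only POLYNOMIALLY — the section
`V − (ζ(2)/8)A` has radius of convergence exactly `1`, i.e. it is overconvergent across Apéry's first
singular point `(√2−1)⁴ ≈ 0.0294` up to the pole `x = 1` of `∑(2n−1)xⁿ`. -/
theorem aperyV_remainder :
    ∃ C : ℝ, ∀ n : ℕ, 1 ≤ n →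
      |(aperyV n : ℝ) - multipleZeta [2] / 8 * (aperyA n : ℝ)| ≤ C / (n : ℝ) ^ 2 := by
  sorry

/-- STUB (checked for `n ≤ 120`): lcm-type 2, `lcm(1,…,n)² · vₙ ∈ ℤ`. -/
theorem aperyV_type (n : ℕ) (hn : 1 ≤ n) :
    ∃ z : ℤ, (z : ℚ) = ((Finset.range (n + 1)).lcm id : ℕ) ^ 2 * aperyV n := by
  sorry

/-- **Shape of the transfer** `crux ⇐ (∀ finite blocks S, an overconvergent holonomic witness for S)
∧ (holonomy bound)`: both the witness predicate `W` and the Calegari–Dimitrov–Tang bound are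
abstracted (`W S` = "the values on `S` are simultaneous Apéry limits of an integral holonomic
module of lcm-type `τ` uniformised with `log |φ′(0)| > τ`"; `hCDT` = their dimension bound read
contrapositively: a witnessed block carries no `ℚ`-relation). Only the logical skeleton is
asserted here; it is `crux_iff_finset`. -/
theorem crux_of_overconvergentWitnesses
    (W : Finset {u : List ℕ // IsHoffman u} → Prop)
    (hW : ∀ s, W s)
    (hCDT : ∀ s, W s → LinearIndependent ℚ
      ((fun u : {u : List ℕ // IsHoffman u} => multipleZeta u.1) ∘
        (Subtype.val : s → {u : List ℕ // IsHoffman u}))) :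
    Crux :=
  crux_iff_finset.2 fun s => hCDT s (hW s)

end Summit.KontsevichZagierPeriods.KontsevichZagierPeriods.Cruxes.HoffmanIndependence.Sketch
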